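import Summits.BirchSwinnertonDyer.BirchSwinnertonDyer.Theorems.GenusKolyvaginAtTwoPowDvdShaCardAtTwoRTRelaxedCount
import Summits.BirchSwinnertonDyer.BirchSwinnertonDyer.Theorems.GenusKolyvaginAtTwoPowDvdShaCardAtTwoRTAuxiliaryClassDeepAllPlaces
import Summits.BirchSwinnertonDyer.Rank1Residual.X11b.BDPRouteSelmerLevelBound
import HarnessLib

/-!
# Route `GenusKolyvaginAtTwo`, crux L_T `PowDvdShaCardAtTwoRT` (stmt-BirchSwinnertonDyer-23242), LINE 18 stub L, bottom rung:
# THE RELAXED LAGRANGIAN COUNT FOR KUMMER SOLUTION GROUPS — `#𝒴 · #G = ∏_{u∈T} #M_u · #𝒴*` over ANY number field, ANY places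

LEAD seat `bsd-line-gk2-p1` g16 (cell `bsd-f1-sign2`), `--supports 23242 --as helper`.  THEOREMS ONLY, no definition, no `sorry`;
standard axioms.  BSD is NOT proved by any of this; neither is the crux nor stub L.

WHY (memo `Cruxes/PowDvdShaCardAtTwoRT/Lines/plus-descent-lead-g16.md` §2).  The bottom rung of the 3a⁗ swap oracle for index-≥2
witnesses needs an auxiliary class of ORDER 4 in a Kummer solution group with `k ≥ 1` free primes; its existence is the comparison of
the EXACT relaxed counts at levels `4` and `2` (`…RTRelaxedCount.exists_two_nsmul_ne_zero_of_counts'`).  This file supplies the exact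
count for the tree's Kummer solution groups: with `G = loc_T(H¹_{𝓛, ⊤ on T}(K, E[p^k]))` (LAGRANGIAN: gk2-p4
`annLeft_map_kummerOutside_eq_places`, `#G² = ∏_{v∈T} #H¹(K_v, E[p^k])`: `natCard_map_kummerOutside_sq_places`) and local conditions
`M_u ≤ H¹(K_u, E[p^k])` (`u ∈ T`; `⊤` at the free places, a coisotropic condition elsewhere), the solution group
`𝒴 = H¹_{𝓛, ⊤ on T} ⊓ loc⁻¹(Π M_u)` and its DUAL `𝒴* = H¹_{𝓛, ⊤ on T} ⊓ loc⁻¹(Π {}^⊥M_u)` satisfy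
**`#𝒴 · #G = (∏_u #M_u) · #𝒴*`**, hence **`#𝒴² · ∏_{v∈T} #H¹(K_v) = (∏_u #M_u)² · #𝒴*²`** — gk2-p4's inequality
`sq_natCard_solutions_ge` (`∏_{free} #H¹ ≤ #𝒴²`) made an equality with the dual group (Wiles' formula in Lagrangian form).
WHAT (namespace `…Theorems.GenusExact.RelaxedCount`):
* `natCard_solutions_mul_eq_kummerOutside` — displayed inputs (`IsPerfect`, `SumLocalTermEqZero`, `SelmerComplement`, Tate's count at
  the finite places, `inv` injective at the real places), `T : Finset (Place K)` any places, `M_u` any subgroups.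
* `natCard_solutions_sq_mul_prod_eq_kummerOutside` — the squared form with `#G` eliminated.
* `natCard_solutions_mul_eq_kummerOutside_canonical` — UNCONDITIONAL for THE canonical Poitou–Tate family (`canonical_isPerfect`,
  `sumLocalTermEqZero_canonical`, `selmerComplement_canonical_holds`, `archimedeanInvariantMap_injective_of_isReal`,
  `localEulerPoincareCharacteristic_holds`), `k ≥ 1`, Weil datum displayed.
* §3 `exists_nsmul_ne_zero_of_counts` (any multiplier `q`) and **`exists_mem_solutions_nsmul_ne_zero_canonical`** — THE ORDER-RAISING
  AUXILIARY CLASS: two levels `p^{k₂}`, `p^{k₄}` with a displayed level map `ι` (injective, Kummer-compatible, `q`-torsion of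
  `H¹_{𝓛,⊤ on T}` in its range, localisation-compatible), ANY conditions `M_u` at level `p^{k₄}`, and the numerical hypothesis
  `∏_u #H¹(K_u,E[p^{k₂}])·∏_u #H¹(K_u,E[p^{k₄}]) < (∏_u #M_u)²` ⟹ a solution `y` with `q•y ≠ 0`; at `(p,k₂,k₄,q) = (2,1,2,2)` with one
  free Kolyvagin prime (`4·16 < 16²`) this is the ORDER-4 auxiliary of the bottom-rung engine (memo §2), with NO `⌈L/2⌉` loss.
HONEST FRAMING: bookkeeping over gk2-p4's maximal-isotropic count; the level-map hypotheses are displayed (tree: `torsionH1OfDvd`);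
closes nothing.  BSD is NOT proved by any of this.

References: [McCallumLMS1991] §2 Prop. 2.1 (proof), §5 proof of Prop. 5.2; [MilneADT2006] Ch. I Cor. 2.3, Thm. 2.8, Thm. 2.13, Thm. 4.10.
-/

set_option autoImplicit false
-- the Theorems namespace of this sub repeats the summit name by design (D-0017 nested layout)
set_option linter.dupNamespace false

noncomputable section

open scoped Classical

open CategoryTheory Field NumberField IsDedekindDomain Function
open Literature.NumberTheory.EllipticCurves
open Literature.NumberTheory.GaloisRepresentations
open Literature.NumberTheory.GaloisCohomology
open Summit.BirchSwinnertonDyer.Rank1Residual.X11b.KummerPT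
open Summit.BirchSwinnertonDyer.Rank1Residual.X11b.FiniteDuality
open Summit.BirchSwinnertonDyer.Rank1Residual.X11b.Relaxation
open Summit.BirchSwinnertonDyer.Rank1Residual.X11b.LocBridge Summit.BirchSwinnertonDyer.Rank1Residual.X11b.Levels
open Summit.BirchSwinnertonDyer.Rank1Residual.X11b.AcSelmer
open scoped ContRepresentation

namespace Summit.BirchSwinnertonDyer.BirchSwinnertonDyer.Theorems.GenusExact.RelaxedCount

open Summit.BirchSwinnertonDyer.BirchSwinnertonDyer.Theorems.GenusKolyKramer (finite_galoisCohomology_toLocal)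
open Summit.BirchSwinnertonDyer.BirchSwinnertonDyer.Theorems.GenusExact.AuxiliaryClass

variable {K : Type} [Field K] [NumberField K] (W : WeierstrassCurve K) [W.IsElliptic]
variable (p k : ℕ) [Fact p.Prime] [Finite (W.geomTorsion ((p ^ k : ℕ) : ℤ))]
variable (e : W.geomTorsion ((p ^ k : ℕ) : ℤ) → W.geomTorsion ((p ^ k : ℕ) : ℤ) → AlgebraicClosure K)
  (hμ : ∀ S T, e S T ^ (p ^ k) = 1)
  (hadd₁ : ∀ S₁ S₂ T, e (S₁ + S₂) T = e S₁ T * e S₂ T)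
  (hadd₂ : ∀ S T₁ T₂, e S (T₁ + T₂) = e S T₁ * e S T₂)
  (hgal : ∀ (σ : absoluteGaloisGroup K) (S T : W.geomTorsion ((p ^ k : ℕ) : ℤ)),
    σ • e S T = e (σ • S) (σ • T))
  (halt : ∀ T, e T T = 1) (hnondeg : ∀ T, (∀ S, e S T = 1) → T = 0)

include halt hnondeg in
/-- **The relaxed Lagrangian count for Kummer solution groups** (displayed inputs; `T` any finite set of places of any number field;
`M_u` any local conditions on `T`): **`#𝒴 · #loc_T(H¹_{𝓛,⊤ on T}) = (∏_{u∈T} #M_u) · #𝒴*`** with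
`𝒴 = H¹_{𝓛,⊤ on T} ⊓ loc⁻¹(Π M_u)`, `𝒴* = H¹_{𝓛,⊤ on T} ⊓ loc⁻¹(Π {}^⊥M_u)` (`{}^⊥` for `inv_u(· ∪ₑ ·)`).
[cite: McCallumLMS1991, §2 proof of Prop. 2.1] [cite: MilneADT2006, Ch. I, Thm. 4.10] -/
theorem natCard_solutions_mul_eq_kummerOutside
    {inv : LocalInvariants K (p ^ k)} (hperf : inv.IsPerfect) (hsum : inv.SumLocalTermEqZero)
    (hcompl : inv.SelmerComplement)
    (hEuler : ∀ v : HeightOneSpectrum (𝓞 K),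
      Nat.card (galoisCohomology ((W.torsionGaloisModule ((p ^ k : ℕ) : ℤ)).toLocal (Sum.inr v)) 1) =
        (Nat.card (nsmulAddMonoidHom (p ^ k) :
            (W.baseChange (v.adicCompletion K)).toAffine.Point →+ _).ker *
          Nat.card (v.adicCompletionIntegers K ⧸
            Ideal.span {((p ^ k : ℕ) : v.adicCompletionIntegers K)})) ^ 2)
    (hreal : ∀ w : InfinitePlace K, w.IsReal → Injective (inv (Sum.inl w)))
    (T : Finset (Place K))
    (loc : galoisCohomology (W.torsionGaloisModule ((p ^ k : ℕ) : ℤ)) 1 →+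
      (∀ u : ↥T, galoisCohomology ((W.torsionGaloisModule ((p ^ k : ℕ) : ℤ)).toLocal (u : Place K)) 1))
    (hloc : ∀ c u, loc c u = galoisCohomology.localization (W.torsionGaloisModule ((p ^ k : ℕ) : ℤ)) (u : Place K) 1 c)
    (M : ∀ u : ↥T, AddSubgroup (galoisCohomology ((W.torsionGaloisModule ((p ^ k : ℕ) : ℤ)).toLocal (u : Place K)) 1)) :
    Nat.card ↥(kummerOutside W (p ^ k) T ⊓ (AddSubgroup.pi Set.univ M).comap loc) *
        Nat.card ↥((kummerOutside W (p ^ k) T).map loc) =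
      (∏ u : ↥T, Nat.card (M u)) *
        Nat.card ↥(kummerOutside W (p ^ k) T ⊓ (AddSubgroup.pi Set.univ (fun u : ↥T ↦
          annLeft (invWeilPairing W (p ^ k) e hμ hadd₁ hadd₂ hgal inv (u : Place K)) (M u))).comap loc) := by
  classical
  haveI hfin : ∀ u : ↥T, Finite (galoisCohomology ((W.torsionGaloisModule ((p ^ k : ℕ) : ℤ)).toLocal (u : Place K)) 1) :=
    fun u ↦ finite_galoisCohomology_toLocal W (p ^ k) u
  have hX : ∀ (u : ↥T) (x : galoisCohomology ((W.torsionGaloisModule ((p ^ k : ℕ) : ℤ)).toLocal (u : Place K)) 1),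
      (p ^ k) • x = 0 := fun u x ↦ nsmul_galoisCohomology_toLocal_eq_zero W (p ^ k) _ x
  have hb : ∀ u : ↥T, Injective (invWeilPairing W (p ^ k) e hμ hadd₁ hadd₂ hgal inv (u : Place K)) :=
    fun u ↦ (invWeilPairing_bijective_place W (p ^ k) e hμ hadd₁ hadd₂ hgal halt hnondeg inv hperf hreal (u : Place K)).1
  have hbflip : ∀ u : ↥T, Injective (invWeilPairing W (p ^ k) e hμ hadd₁ hadd₂ hgal inv (u : Place K)).flip :=
    fun u ↦ (invWeilPairing_flip_bijective_place W (p ^ k) e hμ hadd₁ hadd₂ hgal halt hnondeg inv hperf hreal (u : Place K)).1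
  obtain ⟨bP, hbP⟩ := exists_piSum (fun u : ↥T ↦ invWeilPairing W (p ^ k) e hμ hadd₁ hadd₂ hgal inv (u : Place K))
  have hG := annLeft_map_kummerOutside_eq_places W p k e hμ hadd₁ hadd₂ hgal halt hnondeg hperf hsum hcompl hEuler hreal
    T loc hloc bP hbP
  exact natCard_solutions_mul_eq_pi' hX _ hb hbflip bP hbP loc (kummerOutside W (p ^ k) T) hG M

include halt hnondeg in
/-- **Squared form, `#G` eliminated**: `#𝒴² · ∏_{v∈T} #H¹(K_v, E[p^k]) = (∏_{u∈T} #M_u)² · #𝒴*²` (from the count above and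
`#loc_T(H¹_{𝓛,⊤ on T})² = ∏_{v∈T} #H¹(K_v, E[p^k])`).  Read: `#𝒴/#𝒴* = ∏_u #M_u / #H¹(K_u)^{1/2}` — Wiles' formula for the structure
`(M_u)` relative to the Lagrangian Kummer structure. [cite: McCallumLMS1991, §2 proof of Prop. 2.1] [cite: MilneADT2006, Ch. I, Thm. 4.10] -/
theorem natCard_solutions_sq_mul_prod_eq_kummerOutside
    {inv : LocalInvariants K (p ^ k)} (hperf : inv.IsPerfect) (hsum : inv.SumLocalTermEqZero)
    (hcompl : inv.SelmerComplement)
    (hEuler : ∀ v : HeightOneSpectrum (𝓞 K),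
      Nat.card (galoisCohomology ((W.torsionGaloisModule ((p ^ k : ℕ) : ℤ)).toLocal (Sum.inr v)) 1) =
        (Nat.card (nsmulAddMonoidHom (p ^ k) :
            (W.baseChange (v.adicCompletion K)).toAffine.Point →+ _).ker *
          Nat.card (v.adicCompletionIntegers K ⧸
            Ideal.span {((p ^ k : ℕ) : v.adicCompletionIntegers K)})) ^ 2)
    (hreal : ∀ w : InfinitePlace K, w.IsReal → Injective (inv (Sum.inl w)))
    (T : Finset (Place K))
    (loc : galoisCohomology (W.torsionGaloisModule ((p ^ k : ℕ) : ℤ)) 1 →+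
      (∀ u : ↥T, galoisCohomology ((W.torsionGaloisModule ((p ^ k : ℕ) : ℤ)).toLocal (u : Place K)) 1))
    (hloc : ∀ c u, loc c u = galoisCohomology.localization (W.torsionGaloisModule ((p ^ k : ℕ) : ℤ)) (u : Place K) 1 c)
    (M : ∀ u : ↥T, AddSubgroup (galoisCohomology ((W.torsionGaloisModule ((p ^ k : ℕ) : ℤ)).toLocal (u : Place K)) 1)) :
    Nat.card ↥(kummerOutside W (p ^ k) T ⊓ (AddSubgroup.pi Set.univ M).comap loc) ^ 2 *
        ∏ v ∈ T, Nat.card (galoisCohomology ((W.torsionGaloisModule ((p ^ k : ℕ) : ℤ)).toLocal v) 1) =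
      (∏ u : ↥T, Nat.card (M u)) ^ 2 *
        Nat.card ↥(kummerOutside W (p ^ k) T ⊓ (AddSubgroup.pi Set.univ (fun u : ↥T ↦
          annLeft (invWeilPairing W (p ^ k) e hμ hadd₁ hadd₂ hgal inv (u : Place K)) (M u))).comap loc) ^ 2 := by
  have h := natCard_solutions_mul_eq_kummerOutside W p k e hμ hadd₁ hadd₂ hgal halt hnondeg hperf hsum hcompl hEuler hreal
    T loc hloc M
  have hG := natCard_map_kummerOutside_sq_places W p k e hμ hadd₁ hadd₂ hgal halt hnondeg hperf hsum hcompl hEuler hreal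
    T loc hloc
  have h2 := congrArg (fun x : ℕ ↦ x ^ 2) h
  simp only [mul_pow] at h2
  rw [hG] at h2
  exact h2

omit [Finite (W.geomTorsion ((p ^ k : ℕ) : ℤ))] in
include halt hnondeg in
/-- **The relaxed count for Kummer solution groups — UNCONDITIONAL for THE canonical Poitou–Tate family** (any number field, any
finite set of places `T`, `k ≥ 1`, the Weil pairing datum displayed). [cite: McCallumLMS1991, §2 proof of Prop. 2.1]
[cite: MilneADT2006, Ch. I, Thm. 2.8, Thm. 2.13 and Thm. 4.10] -/
theorem natCard_solutions_mul_eq_kummerOutside_canonical (hk : 0 < k) (T : Finset (Place K))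
    (loc : galoisCohomology (W.torsionGaloisModule ((p ^ k : ℕ) : ℤ)) 1 →+
      (∀ u : ↥T, galoisCohomology ((W.torsionGaloisModule ((p ^ k : ℕ) : ℤ)).toLocal (u : Place K)) 1))
    (hloc : ∀ c u, loc c u = galoisCohomology.localization (W.torsionGaloisModule ((p ^ k : ℕ) : ℤ)) (u : Place K) 1 c)
    (M : ∀ u : ↥T, AddSubgroup (galoisCohomology ((W.torsionGaloisModule ((p ^ k : ℕ) : ℤ)).toLocal (u : Place K)) 1)) :
    Nat.card ↥(kummerOutside W (p ^ k) T ⊓ (AddSubgroup.pi Set.univ M).comap loc) *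
        Nat.card ↥((kummerOutside W (p ^ k) T).map loc) =
      (∏ u : ↥T, Nat.card (M u)) *
        Nat.card ↥(kummerOutside W (p ^ k) T ⊓ (AddSubgroup.pi Set.univ (fun u : ↥T ↦
          annLeft (haveI : Finite (W.geomTorsion ((p ^ k : ℕ) : ℤ)) := finite_geomTorsion_pow W p k
            invWeilPairing W (p ^ k) e hμ hadd₁ hadd₂ hgal (LocalInvariants.canonical K (p ^ k)) (u : Place K))
            (M u))).comap loc) := by
  have hprime : p.Prime := Fact.out
  have hpp : IsPrimePow (p ^ k) := ⟨p, k, hprime.prime, hk, rfl⟩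
  haveI : Finite (W.geomTorsion ((p ^ k : ℕ) : ℤ)) := finite_geomTorsion_pow W p k
  have hperf := LocalInvariants.canonical_isPerfect (K := K) (n := p ^ k)
  have hsum := Summit.BirchSwinnertonDyer.BirchSwinnertonDyer.Theorems.SchneiderFreeAdditiveX3.PoitouTateReduction.sumLocalTermEqZero_canonical
    (K := K) (p ^ k)
  have hcompl := Summit.BirchSwinnertonDyer.BirchSwinnertonDyer.Theorems.SchneiderFreeAdditiveX3.PoitouTateReduction.selmerComplement_canonical_holds
    K (p ^ k)
  have hreal : ∀ w' : InfinitePlace K, w'.IsReal →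
      Injective (LocalInvariants.canonical K (p ^ k) (Sum.inl w')) := fun w' hw' ↦ by
    rw [LocalInvariants.canonical_inl]
    exact archimedeanInvariantMap_injective_of_isReal hw'
  have hEuler : ∀ v : HeightOneSpectrum (𝓞 K),
      Nat.card (galoisCohomology ((W.torsionGaloisModule ((p ^ k : ℕ) : ℤ)).toLocal (Sum.inr v)) 1) =
        (Nat.card (nsmulAddMonoidHom (p ^ k) :
            (W.baseChange (v.adicCompletion K)).toAffine.Point →+ _).ker *
          Nat.card (v.adicCompletionIntegers K ⧸
            Ideal.span {((p ^ k : ℕ) : v.adicCompletionIntegers K)})) ^ 2 := fun v ↦ by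
    haveI : CharZero (v.adicCompletion K) := charZero_adicCompletion v
    exact natCard_galoisCohomology_one_torsion_adicCompletion_eq_sq W v (p ^ k) hpp
      (localEulerPoincareCharacteristic_holds (v.adicCompletion K))
  exact natCard_solutions_mul_eq_kummerOutside W p k e hμ hadd₁ hadd₂ hgal halt hnondeg hperf hsum hcompl hEuler hreal T loc
    hloc M

/-! ## §3 The order-raising auxiliary class from the two-level count -/

section TwoLevel

omit [Finite (W.geomTorsion ((p ^ k : ℕ) : ℤ))]

/-- **Two-level order lemma, any multiplier `q`** (the accepted `exists_two_nsmul_ne_zero_of_counts'` with `2` replaced by `q`):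
`#Y₄·g₄ = m₄·#Y₄*`, `#Y₂·g₂ = m₂·#Y₂*`, `Y₄[q] ⊆ ι(Y₂)`, `ι(Y₂*) ⊆ Y₄*`, `m₂·g₄ < m₄·g₂` ⟹ `∃ y ∈ Y₄, q•y ≠ 0`. [folklore] -/
theorem exists_nsmul_ne_zero_of_counts {W₂ : Type*} [AddCommGroup W₂] {W₄ : Type*} [AddCommGroup W₄] (q : ℕ)
    (ι : W₂ →+ W₄) (hι : Injective ι) (Y₄ Y₄' : AddSubgroup W₄) (Y₂ Y₂' : AddSubgroup W₂) [Finite Y₂] [Finite Y₄']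
    {g₂ g₄ m₂ m₄ : ℕ} (h4 : Nat.card Y₄ * g₄ = m₄ * Nat.card Y₄') (h2 : Nat.card Y₂ * g₂ = m₂ * Nat.card Y₂')
    (htors : ∀ y ∈ Y₄, q • y = 0 → y ∈ Y₂.map ι) (hdual : Y₂'.map ι ≤ Y₄') (hlt : m₂ * g₄ < m₄ * g₂) :
    ∃ y ∈ Y₄, q • y ≠ 0 := by
  by_contra hne
  push Not at hne
  haveI : Finite ↥(Y₂.map ι) := Finite.of_surjective _ (AddMonoidHom.addSubgroupMap_surjective ι Y₂)
  have hle : Nat.card Y₄ ≤ Nat.card Y₂ := by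
    calc Nat.card Y₄ ≤ Nat.card ↥(Y₂.map ι) :=
          AddSubgroup.card_le_of_le fun y hy ↦ htors y hy (hne y hy)
      _ ≤ Nat.card Y₂ := Nat.card_le_card_of_surjective _ (AddMonoidHom.addSubgroupMap_surjective ι Y₂)
  have hle' : Nat.card Y₂' ≤ Nat.card Y₄' := by
    calc Nat.card Y₂' = Nat.card ↥(Y₂'.map ι) := Nat.card_congr (Y₂'.equivMapOfInjective ι hι).toEquiv
      _ ≤ Nat.card Y₄' := AddSubgroup.card_le_of_le hdual
  have hpos : 0 < Nat.card Y₄' := Nat.card_pos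
  have key : Nat.card Y₄ * g₄ * g₂ < Nat.card Y₄ * g₄ * g₂ := by
    calc Nat.card Y₄ * g₄ * g₂ ≤ Nat.card Y₂ * g₂ * g₄ := by
          rw [mul_right_comm]; exact Nat.mul_le_mul_right _ (Nat.mul_le_mul_right _ hle)
      _ = m₂ * g₄ * Nat.card Y₂' := by rw [h2]; ring
      _ ≤ m₂ * g₄ * Nat.card Y₄' := Nat.mul_le_mul_left _ hle'
      _ < m₄ * g₂ * Nat.card Y₄' := Nat.mul_lt_mul_of_pos_right hlt hpos
      _ = Nat.card Y₄ * g₄ * g₂ := by rw [mul_right_comm, ← h4]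
  exact lt_irrefl _ key

variable (k₂ k₄ : ℕ)
variable (e₂ : W.geomTorsion ((p ^ k₂ : ℕ) : ℤ) → W.geomTorsion ((p ^ k₂ : ℕ) : ℤ) → AlgebraicClosure K)
  (hμ₂ : ∀ S T, e₂ S T ^ (p ^ k₂) = 1)
  (hadd₁₂ : ∀ S₁ S₂ T, e₂ (S₁ + S₂) T = e₂ S₁ T * e₂ S₂ T)
  (hadd₂₂ : ∀ S T₁ T₂, e₂ S (T₁ + T₂) = e₂ S T₁ * e₂ S T₂)
  (hgal₂ : ∀ (σ : absoluteGaloisGroup K) (S T : W.geomTorsion ((p ^ k₂ : ℕ) : ℤ)), σ • e₂ S T = e₂ (σ • S) (σ • T))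
  (halt₂ : ∀ T, e₂ T T = 1) (hnondeg₂ : ∀ T, (∀ S, e₂ S T = 1) → T = 0)
variable (e₄ : W.geomTorsion ((p ^ k₄ : ℕ) : ℤ) → W.geomTorsion ((p ^ k₄ : ℕ) : ℤ) → AlgebraicClosure K)
  (hμ₄ : ∀ S T, e₄ S T ^ (p ^ k₄) = 1)
  (hadd₁₄ : ∀ S₁ S₂ T, e₄ (S₁ + S₂) T = e₄ S₁ T * e₄ S₂ T)
  (hadd₂₄ : ∀ S T₁ T₂, e₄ S (T₁ + T₂) = e₄ S T₁ * e₄ S T₂)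
  (hgal₄ : ∀ (σ : absoluteGaloisGroup K) (S T : W.geomTorsion ((p ^ k₄ : ℕ) : ℤ)), σ • e₄ S T = e₄ (σ • S) (σ • T))
  (halt₄ : ∀ T, e₄ T T = 1) (hnondeg₄ : ∀ T, (∀ S, e₄ S T = 1) → T = 0)

include halt₂ hnondeg₂ halt₄ hnondeg₄ hμ₂ hadd₁₂ hadd₂₂ hgal₂ hμ₄ hadd₁₄ hadd₂₄ hgal₄ in
/-- **THE ORDER-RAISING AUXILIARY CLASS (two-level count, unconditional inputs).**  Two levels `p^{k₂}`, `p^{k₄}` (`k₂, k₄ ≥ 1`) with a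
level map `ι : H¹(K, E[p^{k₂}]) → H¹(K, E[p^{k₄}])` (displayed: injective; maps `H¹_{𝓛,⊤ on T}` into `H¹_{𝓛,⊤ on T}`; every class of
`H¹_{𝓛,⊤ on T}` at level `p^{k₄}` killed by `q` comes from level `p^{k₂}`; compatible with vanishing of localisations — in the tree
`ι = torsionH1OfDvd`, `torsionH1OfDvd_mem_selmerLocalKer_iff`, `torsionH1OfDvd_two_pow_injective`), a finite set of places `T` with ANY
local conditions `M_u ≤ H¹(K_u, E[p^{k₄}])` (e.g. `⊤` at the free places, `res⁻¹(values in the eigen-line)` at the deep own primes; no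
compatibility with level `p^{k₂}` is needed — the comparison group at level `p^{k₂}` is all of `H¹_{𝓛,⊤ on T}`), and the NUMERICAL HYPOTHESIS
`∏_{u∈T} #H¹(K_u,E[p^{k₂}]) · ∏_{u∈T} #H¹(K_u,E[p^{k₄}]) < (∏_{u∈T} #M_u)²` (true as soon as one place of `T` is free when
`k₄ = k₂ + 1`): then the solution group `𝒴 = H¹_{𝓛,⊤ on T}(K,E[p^{k₄}]) ⊓ loc⁻¹(Π M_u)` contains a class `y` with **`q • y ≠ 0`**.  With
`p = 2`, `(k₂,k₄) = (1,2)`, `q = 2`: an auxiliary class of ORDER 4 for the bottom-rung engine of LINE 18 (memo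
`Lines/plus-descent-lead-g16.md` §2).  Proof: the relaxed counts at the two levels (`natCard_solutions_mul_eq_kummerOutside_canonical`),
`#G² = ∏ #H¹` at both levels, and `exists_nsmul_ne_zero_of_counts`. [cite: McCallumLMS1991, §2 Prop. 2.1 and §5 proof of Prop. 5.2]
[cite: MilneADT2006, Ch. I, Thm. 2.8, Thm. 2.13 and Thm. 4.10] -/
theorem exists_mem_solutions_nsmul_ne_zero_canonical (hk₂ : 0 < k₂) (hk₄ : 0 < k₄) (q : ℕ) (T : Finset (Place K))
    (loc₂ : galoisCohomology (W.torsionGaloisModule ((p ^ k₂ : ℕ) : ℤ)) 1 →+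
      (∀ u : ↥T, galoisCohomology ((W.torsionGaloisModule ((p ^ k₂ : ℕ) : ℤ)).toLocal (u : Place K)) 1))
    (hloc₂ : ∀ c u, loc₂ c u = galoisCohomology.localization (W.torsionGaloisModule ((p ^ k₂ : ℕ) : ℤ)) (u : Place K) 1 c)
    (loc₄ : galoisCohomology (W.torsionGaloisModule ((p ^ k₄ : ℕ) : ℤ)) 1 →+
      (∀ u : ↥T, galoisCohomology ((W.torsionGaloisModule ((p ^ k₄ : ℕ) : ℤ)).toLocal (u : Place K)) 1))
    (hloc₄ : ∀ c u, loc₄ c u = galoisCohomology.localization (W.torsionGaloisModule ((p ^ k₄ : ℕ) : ℤ)) (u : Place K) 1 c)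
    (ι : galoisCohomology (W.torsionGaloisModule ((p ^ k₂ : ℕ) : ℤ)) 1 →+
      galoisCohomology (W.torsionGaloisModule ((p ^ k₄ : ℕ) : ℤ)) 1)
    (hι : Injective ι)
    (hKO : ∀ c ∈ kummerOutside W (p ^ k₂) T, ι c ∈ kummerOutside W (p ^ k₄) T)
    (htors : ∀ y ∈ kummerOutside W (p ^ k₄) T, q • y = 0 → ∃ c ∈ kummerOutside W (p ^ k₂) T, ι c = y)
    (hloc0 : ∀ c (u : ↥T), loc₂ c u = 0 → loc₄ (ι c) u = 0)
    (M : ∀ u : ↥T, AddSubgroup (galoisCohomology ((W.torsionGaloisModule ((p ^ k₄ : ℕ) : ℤ)).toLocal (u : Place K)) 1))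
    (hlt : (∏ u : ↥T, Nat.card (galoisCohomology ((W.torsionGaloisModule ((p ^ k₂ : ℕ) : ℤ)).toLocal (u : Place K)) 1)) *
        (∏ u : ↥T, Nat.card (galoisCohomology ((W.torsionGaloisModule ((p ^ k₄ : ℕ) : ℤ)).toLocal (u : Place K)) 1)) <
      (∏ u : ↥T, Nat.card (M u)) ^ 2) :
    ∃ y ∈ kummerOutside W (p ^ k₄) T ⊓ (AddSubgroup.pi Set.univ M).comap loc₄, q • y ≠ 0 := by
  classical
  have hprime : p.Prime := Fact.out
  haveI : NeZero (p ^ k₂) := ⟨pow_ne_zero _ hprime.ne_zero⟩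
  haveI : NeZero (p ^ k₄) := ⟨pow_ne_zero _ hprime.ne_zero⟩
  haveI hfin₂T : Finite (W.geomTorsion ((p ^ k₂ : ℕ) : ℤ)) := finite_geomTorsion_pow W p k₂
  haveI hfin₄T : Finite (W.geomTorsion ((p ^ k₄ : ℕ) : ℤ)) := finite_geomTorsion_pow W p k₄
  haveI hfin₂ : ∀ u : ↥T, Finite (galoisCohomology ((W.torsionGaloisModule ((p ^ k₂ : ℕ) : ℤ)).toLocal (u : Place K)) 1) :=
    fun u ↦ finite_galoisCohomology_toLocal W (p ^ k₂) u
  haveI hfin₄ : ∀ u : ↥T, Finite (galoisCohomology ((W.torsionGaloisModule ((p ^ k₄ : ℕ) : ℤ)).toLocal (u : Place K)) 1) :=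
    fun u ↦ finite_galoisCohomology_toLocal W (p ^ k₄) u
  -- the canonical inputs at both levels
  have hpp₂ : IsPrimePow (p ^ k₂) := ⟨p, k₂, hprime.prime, hk₂, rfl⟩
  have hpp₄ : IsPrimePow (p ^ k₄) := ⟨p, k₄, hprime.prime, hk₄, rfl⟩
  have hperf₂ := LocalInvariants.canonical_isPerfect (K := K) (n := p ^ k₂)
  have hperf₄ := LocalInvariants.canonical_isPerfect (K := K) (n := p ^ k₄)
  have hsum₂ := Summit.BirchSwinnertonDyer.BirchSwinnertonDyer.Theorems.SchneiderFreeAdditiveX3.PoitouTateReduction.sumLocalTermEqZero_canonical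
    (K := K) (p ^ k₂)
  have hsum₄ := Summit.BirchSwinnertonDyer.BirchSwinnertonDyer.Theorems.SchneiderFreeAdditiveX3.PoitouTateReduction.sumLocalTermEqZero_canonical
    (K := K) (p ^ k₄)
  have hcompl₂ := Summit.BirchSwinnertonDyer.BirchSwinnertonDyer.Theorems.SchneiderFreeAdditiveX3.PoitouTateReduction.selmerComplement_canonical_holds
    K (p ^ k₂)
  have hcompl₄ := Summit.BirchSwinnertonDyer.BirchSwinnertonDyer.Theorems.SchneiderFreeAdditiveX3.PoitouTateReduction.selmerComplement_canonical_holds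
    K (p ^ k₄)
  have hreal₂ : ∀ w' : InfinitePlace K, w'.IsReal →
      Injective (LocalInvariants.canonical K (p ^ k₂) (Sum.inl w')) := fun w' hw' ↦ by
    rw [LocalInvariants.canonical_inl]; exact archimedeanInvariantMap_injective_of_isReal hw'
  have hreal₄ : ∀ w' : InfinitePlace K, w'.IsReal →
      Injective (LocalInvariants.canonical K (p ^ k₄) (Sum.inl w')) := fun w' hw' ↦ by
    rw [LocalInvariants.canonical_inl]; exact archimedeanInvariantMap_injective_of_isReal hw'
  have hEuler₂ : ∀ v : HeightOneSpectrum (𝓞 K),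
      Nat.card (galoisCohomology ((W.torsionGaloisModule ((p ^ k₂ : ℕ) : ℤ)).toLocal (Sum.inr v)) 1) =
        (Nat.card (nsmulAddMonoidHom (p ^ k₂) :
            (W.baseChange (v.adicCompletion K)).toAffine.Point →+ _).ker *
          Nat.card (v.adicCompletionIntegers K ⧸
            Ideal.span {((p ^ k₂ : ℕ) : v.adicCompletionIntegers K)})) ^ 2 := fun v ↦ by
    haveI : CharZero (v.adicCompletion K) := charZero_adicCompletion v
    exact natCard_galoisCohomology_one_torsion_adicCompletion_eq_sq W v (p ^ k₂) hpp₂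
      (localEulerPoincareCharacteristic_holds (v.adicCompletion K))
  have hEuler₄ : ∀ v : HeightOneSpectrum (𝓞 K),
      Nat.card (galoisCohomology ((W.torsionGaloisModule ((p ^ k₄ : ℕ) : ℤ)).toLocal (Sum.inr v)) 1) =
        (Nat.card (nsmulAddMonoidHom (p ^ k₄) :
            (W.baseChange (v.adicCompletion K)).toAffine.Point →+ _).ker *
          Nat.card (v.adicCompletionIntegers K ⧸
            Ideal.span {((p ^ k₄ : ℕ) : v.adicCompletionIntegers K)})) ^ 2 := fun v ↦ by
    haveI : CharZero (v.adicCompletion K) := charZero_adicCompletion v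
    exact natCard_galoisCohomology_one_torsion_adicCompletion_eq_sq W v (p ^ k₄) hpp₄
      (localEulerPoincareCharacteristic_holds (v.adicCompletion K))
  -- the two relaxed counts and the two maximal-isotropic counts
  set M₂ : ∀ u : ↥T, AddSubgroup (galoisCohomology ((W.torsionGaloisModule ((p ^ k₂ : ℕ) : ℤ)).toLocal (u : Place K)) 1) :=
    fun _ ↦ ⊤ with hM₂
  have h4 := natCard_solutions_mul_eq_kummerOutside W p k₄ e₄ hμ₄ hadd₁₄ hadd₂₄ hgal₄ halt₄ hnondeg₄ hperf₄ hsum₄ hcompl₄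
    hEuler₄ hreal₄ T loc₄ hloc₄ M
  have h2 := natCard_solutions_mul_eq_kummerOutside W p k₂ e₂ hμ₂ hadd₁₂ hadd₂₂ hgal₂ halt₂ hnondeg₂ hperf₂ hsum₂ hcompl₂
    hEuler₂ hreal₂ T loc₂ hloc₂ M₂
  have hG4 := natCard_map_kummerOutside_sq_places W p k₄ e₄ hμ₄ hadd₁₄ hadd₂₄ hgal₄ halt₄ hnondeg₄ hperf₄ hsum₄ hcompl₄
    hEuler₄ hreal₄ T loc₄ hloc₄
  have hG2 := natCard_map_kummerOutside_sq_places W p k₂ e₂ hμ₂ hadd₁₂ hadd₂₂ hgal₂ halt₂ hnondeg₂ hperf₂ hsum₂ hcompl₂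
    hEuler₂ hreal₂ T loc₂ hloc₂
  rw [← Finset.prod_coe_sort T] at hG4 hG2
  -- `m₂ = ∏ #H¹(K_u, E[p^{k₂}])`
  have hm₂ : (∏ u : ↥T, Nat.card (M₂ u)) =
      ∏ u : ↥T, Nat.card (galoisCohomology ((W.torsionGaloisModule ((p ^ k₂ : ℕ) : ℤ)).toLocal (u : Place K)) 1) :=
    Finset.prod_congr rfl fun u _ ↦ by rw [hM₂]; exact AddSubgroup.card_top
  rw [hm₂] at h2
  -- finiteness of the solution groups
  have hfinKO₂ : Finite (kummerOutside W (p ^ k₂) T) :=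
    Summit.BirchSwinnertonDyer.Rank1Residual.X11b.SelmerLevelBound.finite_kummerOutside W (p ^ k₂) T
  have hfinKO₄ : Finite (kummerOutside W (p ^ k₄) T) :=
    Summit.BirchSwinnertonDyer.Rank1Residual.X11b.SelmerLevelBound.finite_kummerOutside W (p ^ k₄) T
  haveI : Finite ↥(kummerOutside W (p ^ k₂) T ⊓ (AddSubgroup.pi Set.univ M₂).comap loc₂) :=
    Finite.of_injective _ (AddSubgroup.inclusion_injective (inf_le_left : kummerOutside W (p ^ k₂) T ⊓ _ ≤ _))
  haveI : Finite ↥(kummerOutside W (p ^ k₄) T ⊓ (AddSubgroup.pi Set.univ (fun u : ↥T ↦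
      annLeft (invWeilPairing W (p ^ k₄) e₄ hμ₄ hadd₁₄ hadd₂₄ hgal₄ (LocalInvariants.canonical K (p ^ k₄)) (u : Place K))
        (M u))).comap loc₄) :=
    Finite.of_injective _ (AddSubgroup.inclusion_injective (inf_le_left : kummerOutside W (p ^ k₄) T ⊓ _ ≤ _))
  refine exists_nsmul_ne_zero_of_counts q ι hι _ _ _ _ h4 h2 ?_ ?_ ?_
  · -- `q`-torsion of `𝒴₄` comes from level `p^{k₂}` (and every level-`p^{k₂}` class of `H¹_{𝓛,⊤ on T}` satisfies `M₂ = ⊤`)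
    rintro y ⟨hyKO, -⟩ hqy
    obtain ⟨c, hc, rfl⟩ := htors y hyKO hqy
    exact ⟨c, ⟨hc, (AddSubgroup.mem_comap).mpr ((AddSubgroup.mem_pi _).mpr fun u _ ↦ by
      rw [hM₂]; exact AddSubgroup.mem_top _)⟩, rfl⟩
  · -- `ι(𝒴₂*) ≤ 𝒴₄*`: a class vanishing on `T` at level `p^{k₂}` maps to one vanishing on `T`, and `0 ∈ {}^⊥M_u`
    rintro _ ⟨c, ⟨hcKO, hc0⟩, rfl⟩
    refine ⟨hKO c hcKO, (AddSubgroup.mem_comap).mpr ((AddSubgroup.mem_pi _).mpr fun u _ ↦ ?_)⟩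
    have hcu : loc₂ c u ∈ annLeft (invWeilPairing W (p ^ k₂) e₂ hμ₂ hadd₁₂ hadd₂₂ hgal₂ (LocalInvariants.canonical K (p ^ k₂))
        (u : Place K)) (M₂ u) := (AddSubgroup.mem_pi _).mp ((AddSubgroup.mem_comap).mp hc0) u (Set.mem_univ _)
    have hzero : loc₂ c u = 0 := by
      apply (invWeilPairing_bijective_place W (p ^ k₂) e₂ hμ₂ hadd₁₂ hadd₂₂ hgal₂ halt₂ hnondeg₂
        (LocalInvariants.canonical K (p ^ k₂)) hperf₂ hreal₂ (u : Place K)).1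
      ext x
      rw [map_zero, AddMonoidHom.zero_apply]
      exact (mem_annLeft_iff _ _ _).mp hcu x (by rw [hM₂]; exact AddSubgroup.mem_top _)
    have h0 : loc₄ (ι c) u = 0 := hloc0 c u hzero
    change loc₄ (ι c) u ∈ _
    rw [h0]
    exact AddSubgroup.zero_mem _
  · -- the numerical hypothesis, squared: `(m₂ g₄)² = (∏#H¹₂)²·∏#H¹₄ < (∏#M)²·∏#H¹₂ = (m₄ g₂)²`
    have hpos₂ : 0 < ∏ u : ↥T, Nat.card (galoisCohomology ((W.torsionGaloisModule ((p ^ k₂ : ℕ) : ℤ)).toLocal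
        (u : Place K)) 1) := Finset.prod_pos fun u _ ↦ Nat.card_pos
    refine (Nat.pow_lt_pow_iff_left two_ne_zero).mp ?_
    rw [mul_pow, mul_pow, hG4, hG2]
    calc (∏ u : ↥T, Nat.card (galoisCohomology ((W.torsionGaloisModule ((p ^ k₂ : ℕ) : ℤ)).toLocal (u : Place K)) 1)) ^ 2 *
          ∏ u : ↥T, Nat.card (galoisCohomology ((W.torsionGaloisModule ((p ^ k₄ : ℕ) : ℤ)).toLocal (u : Place K)) 1)
        = ((∏ u : ↥T, Nat.card (galoisCohomology ((W.torsionGaloisModule ((p ^ k₂ : ℕ) : ℤ)).toLocal (u : Place K)) 1)) *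
            ∏ u : ↥T, Nat.card (galoisCohomology ((W.torsionGaloisModule ((p ^ k₄ : ℕ) : ℤ)).toLocal (u : Place K)) 1)) *
          ∏ u : ↥T, Nat.card (galoisCohomology ((W.torsionGaloisModule ((p ^ k₂ : ℕ) : ℤ)).toLocal (u : Place K)) 1) := by
          ring
      _ < (∏ u : ↥T, Nat.card (M u)) ^ 2 *
          ∏ u : ↥T, Nat.card (galoisCohomology ((W.torsionGaloisModule ((p ^ k₂ : ℕ) : ℤ)).toLocal (u : Place K)) 1) :=
          Nat.mul_lt_mul_of_pos_right hlt hpos₂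

end TwoLevel

end Summit.BirchSwinnertonDyer.BirchSwinnertonDyer.Theorems.GenusExact.RelaxedCount

end
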